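import Literature.Analysis.Complex.HormanderL2Density
import Literature.Analysis.Complex.HormanderL2Exhaustion
import Literature.Analysis.InnerProduct.AdjointRangeEstimate
import HarnessLib

/-!
# Hörmander's `L²` existence theorem for `∂̄` on a flat Riemann domain (Lemma 4.4.1, `q = 0`)

Layer `Literature/Analysis/Complex`; the transplant of L. Hörmander, *An Introduction to Complex Analysis
in Several Variables* (1973), Lemma 4.4.1 (p. 92) from pseudoconvex open sets of `ℂⁿ` to a Riemann
domain `D` over `ℂ^ι` carrying a `C^∞` exhaustion function `s` with compact sublevel sets and positive
definite Levi form (the rôle of the strictly plurisubharmonic exhaustion of Theorem 2.6.11).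

**Theorem** (`hormander_existence`). Let `φ ∈ C^∞(D)` with `∑ φ_{jk̄} v_j v̄_k ≥ c |v|²`, `c > 0`
continuous, and let `g` be a `C^∞` compactly supported `(0,1)`-form with `∂̄ g = 0`. Then there is
`u ∈ L²(D, e^{-φ})` with `∂̄ u = g` weakly and `∫ |u|² e^{-φ} ≤ 2 ∫ |g|² e^{-φ} / c`.

Proof as printed (p. 92): for every level `a` the weights `φ' = φ + χ_a(s)`, `ψ_a`
(`HormanderL2Exhaustion`) satisfy (4.1.6)/(4.2.2), the estimate of `HormanderL2Density`
(`hormander_estimate_of_mem_F`) and Cauchy–Schwarz give `|(g, f)_{φ₂}| ≤ M ‖T* f‖_{φ₁}` on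
`D_{T*} ∩ F` with `M² = 2 ∫ |g|² e^{-φ}/c` independent of `a`, the abstract range theorem
(`Literature.Analysis.InnerProduct.exists_weak_solution_of_adjoint_inner_estimate`) gives `u_a` with
`‖u_a‖_{φ₁} ≤ M` and `T u_a = g` (`exists_solution_level`); then `a → ∞`: the `u_a` are bounded in one
weighted space `L²(e^{-φ-τ(s)})`, a weak limit along an ultrafilter (Riesz representation) solves
`∂̄ u = g` and satisfies `∫_{s ≤ N} |u|² e^{-φ} ≤ M²` for every `N`.

Everything is proved; no named facts.

## References

* L. Hörmander, *An Introduction to Complex Analysis in Several Variables* (1973), Lemma 4.4.1, p. 92;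
  Lemma 4.1.1–4.1.3, §4.2. [HormanderSCV1973]

#harness_tags complex_analysis.several_variables, complex_analysis.l2_estimates, complex_geometry.riemann_existence
-/

noncomputable section

open scoped Manifold ContDiff Topology ComplexConjugate NNReal InnerProductSpace ENNReal
open scoped LinearPMap
open Set Filter Function Complex MeasureTheory MeasureTheory.Measure

namespace Literature.Analysis.Complex

namespace RiemannDomain

universe u

variable {ι : Type} [Fintype ι] [DecidableEq ι] {D : RiemannDomain.{u} ι}

/-! ### Tools -/

section Tools

omit [DecidableEq ι] in
/-- If `u` is locally constant near `x` then its flat derivative vanishes at `x`. [folklore] -/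
theorem fderivF_eq_zero_of_eventuallyEq_const {G : Type*} [NormedAddCommGroup G] [NormedSpace ℂ G]
    {u : D → G} {x : D} {c : G} (h : u =ᶠ[𝓝 x] fun _ ↦ c) : fderivF u x = 0 := by
  rw [fderivF]
  have hc : ContinuousAt (D.chart x).symm (D.proj x) := (D.chart x).continuousAt_symm (D.proj_mem_chart_target x)
  have ht : Tendsto (D.chart x).symm (𝓝 (D.proj x)) (𝓝 x) := by
    have := hc.tendsto; rwa [D.chart_symm_proj] at this
  have hev : (u ∘ (D.chart x).symm) =ᶠ[𝓝 (D.proj x)] fun _ ↦ c := by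
    filter_upwards [ht.eventually h] with z hz; exact hz
  rw [hev.fderiv_eq, fderiv_const_apply]

omit [DecidableEq ι] in
/-- If `u` is locally constant near `x` then `∂_v u (x) = 0`. [folklore] -/
theorem del_eq_zero_of_eventuallyEq_const {u : D → ℂ} {x : D} {c : ℂ} (h : u =ᶠ[𝓝 x] fun _ ↦ c) (v : ι → ℂ) :
    del v u x = 0 := by
  rw [del_eq_fderivF, fderivF_eq_zero_of_eventuallyEq_const h]; simp

omit [DecidableEq ι] in
/-- Bound of a continuous function on the compact sublevel sets of an exhaustion. [folklore] -/
theorem exists_bound_on_sublevel {s : D → ℝ} (hsK : ∀ b : ℝ, IsCompact {x | s x ≤ b}) {Q : D → ℝ} (hQ : Continuous Q) (b : ℝ) :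
    ∃ M : ℝ, ∀ x, s x ≤ b → Q x ≤ M := by
  obtain ⟨M, hM⟩ := (hsK b).bddAbove_image hQ.continuousOn
  exact ⟨M, fun x hx ↦ hM ⟨x, hx, rfl⟩⟩

end Tools

/-! ### The weights at level `a` -/

section Level

open Weights

variable {φ s : D → ℝ} (hφ : ContMDiff 𝓘(ℝ, ι → ℂ) 𝓘(ℝ, ℝ) ∞ φ) (hs : ContMDiff 𝓘(ℝ, ι → ℂ) 𝓘(ℝ, ℝ) ∞ s)
  (hsK : ∀ b : ℝ, IsCompact {x | s x ≤ b})
  {c m : D → ℝ} (hc : Continuous c) (hc0 : ∀ x, 0 < c x) (hm : Continuous m) (hm0 : ∀ x, 0 < m x)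
  (hLevi : ∀ (x : D) (v : ι → ℂ), c x * ∑ j, ‖v j‖ ^ 2 ≤
    (∑ j, ∑ k, del (Pi.single j 1) (dbar (Pi.single k 1) (fun z ↦ (φ z : ℂ))) x * v j * conj (v k)).re)
  (hsLevi : ∀ (x : D) (v : ι → ℂ), m x * ∑ j, ‖v j‖ ^ 2 ≤
    (∑ j, ∑ k, del (Pi.single j 1) (dbar (Pi.single k 1) (fun z ↦ (s z : ℂ))) x * v j * conj (v k)).re)

include hφ hs hsK hm hm0 hLevi hsLevi in
/-- **The weights at level `a`** (first paragraph of the proof of Lemma 4.4.1): a smooth `ψ ≥ 0`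
vanishing on `{s ≤ a + 2}`, a smooth `φ' = φ + χ(s)` with `χ ≥ 0`, `χ = 0` on `(-∞, a]`,
`φ' - 2ψ ≥ φ`, the Levi bound `∑ φ'_{jk̄} v_j v̄_k ≥ (c + 2|∂ψ|²) |v|²`, and cut-offs `η_ν` with
(4.2.2) `∑_k |∂̄_k η_ν|² ≤ e^{ψ}`. [cite: HormanderSCV1973, proof of Lemma 4.4.1 (p. 92), §4.2 (4.2.1)–(4.2.2)] -/
theorem exists_level_weights (a : ℝ) :
    ∃ (ψ : D → ℝ) (χ : ℝ → ℝ) (η : ℕ → D → ℝ),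
      ContMDiff 𝓘(ℝ, ι → ℂ) 𝓘(ℝ, ℝ) ∞ ψ ∧ (∀ x, 0 ≤ ψ x) ∧ (∀ x, s x ≤ a + 2 → ψ x = 0) ∧
      ContDiff ℝ ∞ χ ∧ (∀ r, 0 ≤ χ r) ∧ (∀ r ≤ a, χ r = 0) ∧
      (∀ x, 2 * ψ x ≤ χ (s x)) ∧
      (∀ (x : D) (v : ι → ℂ), (c x + 2 * ∑ j, ‖del (Pi.single j 1) (fun y ↦ (ψ y : ℂ)) x‖ ^ 2) * ∑ j, ‖v j‖ ^ 2 ≤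
        (∑ j, ∑ k, del (Pi.single j 1) (dbar (Pi.single k 1) (fun z ↦ ((φ z + χ (s z) : ℝ) : ℂ))) x * v j * conj (v k)).re) ∧
      (∀ ν, ContMDiff 𝓘(ℝ, ι → ℂ) 𝓘(ℝ, ℝ) ∞ (η ν)) ∧ (∀ ν, HasCompactSupport (η ν)) ∧
      (∀ ν x, η ν x ∈ Icc (0 : ℝ) 1) ∧ (∀ x, ∀ᶠ ν in atTop, ∀ᶠ y in 𝓝 x, η ν y = 1) ∧
      (∀ ν x, ∑ k, ‖dbar (Pi.single k 1) (fun y ↦ (η ν y : ℂ)) x‖ ^ 2 ≤ Real.exp (ψ x)) := by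
  -- the cut-offs and `ψ`
  obtain ⟨Cσ, hCσ0, hCσ, hCσ'⟩ := exists_bound_deriv_smoothTransition
  set ψ : D → ℝ := exhaustionPsi s a (Cσ ^ 2) with hψdef
  have hψs : ContMDiff 𝓘(ℝ, ι → ℂ) 𝓘(ℝ, ℝ) ∞ ψ := contMDiff_exhaustionPsi hs a (sq_nonneg _)
  have hψ0 : ∀ x, 0 ≤ ψ x := fun x ↦ exhaustionPsi_nonneg a (sq_nonneg _) x
  have hψz : ∀ x, s x ≤ a + 2 → ψ x = 0 := fun x hx ↦ exhaustionPsi_eq_zero a _ hx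
  -- the requirements on `χ`: `Q = max (2ψ) (2|∂ψ|²/m)` on the sublevel sets
  set Q : D → ℝ := fun x ↦ max (2 * ψ x) (2 * (∑ j, ‖del (Pi.single j 1) (fun y ↦ (ψ y : ℂ)) x‖ ^ 2) / m x) with hQ
  have hQc : Continuous Q := by
    refine (continuous_const.mul hψs.continuous).max ((continuous_const.mul ?_).div hm fun x ↦ (hm0 x).ne')
    exact continuous_finsetSum _ fun j _ ↦ ((contMDiff_del (contMDiff_ofReal hψs) _).continuous.norm).pow 2
  choose q hq using fun k : ℕ ↦ exists_bound_on_sublevel hsK hQc (a + 4 + k)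
  obtain ⟨χ, hχs, hχa, hχ0, hχ1, hχ2, hχq⟩ := exists_smooth_convex_majorant a q
  -- the key pointwise consequences
  have hkey : ∀ x, 2 * ψ x ≤ χ (s x) ∧ 2 * (∑ j, ‖del (Pi.single j 1) (fun y ↦ (ψ y : ℂ)) x‖ ^ 2) ≤ deriv χ (s x) * m x := by
    intro x
    rcases lt_or_ge (s x) (a + 2) with hx | hx
    · -- `ψ = 0` near `x`
      have hψ0' : (fun y ↦ (ψ y : ℂ)) =ᶠ[𝓝 x] fun _ ↦ 0 := by
        filter_upwards [(isOpen_lt hs.continuous continuous_const).mem_nhds hx] with y hy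
        rw [hψz y (le_of_lt hy), ofReal_zero]
      have hd : ∀ j, del (Pi.single j 1) (fun y ↦ (ψ y : ℂ)) x = 0 := fun j ↦ del_eq_zero_of_eventuallyEq_const hψ0' _
      refine ⟨by rw [hψz x hx.le, mul_zero]; exact hχ0 _, ?_⟩
      simp only [hd, norm_zero]
      rw [Finset.sum_eq_zero fun j _ ↦ by norm_num]
      rw [mul_zero]; exact mul_nonneg (hχ1 _) (hm0 x).le
    · set k : ℕ := ⌊s x - a - 2⌋₊ with hk
      have hk1 : (k : ℝ) ≤ s x - a - 2 := Nat.floor_le (by linarith)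
      have hk2 : s x - a - 2 < k + 1 := Nat.lt_floor_add_one _
      obtain ⟨hχx, hχ'x⟩ := hχq k (s x) (by linarith) (by linarith)
      have hQx : Q x ≤ q k := hq k x (by linarith)
      have h1 : 2 * ψ x ≤ Q x := le_max_left _ _
      have h2 : 2 * (∑ j, ‖del (Pi.single j 1) (fun y ↦ (ψ y : ℂ)) x‖ ^ 2) / m x ≤ Q x := le_max_right _ _
      refine ⟨h1.trans (hQx.trans hχx), ?_⟩
      rw [div_le_iff₀ (hm0 x)] at h2
      calc _ ≤ Q x * m x := h2
        _ ≤ deriv χ (s x) * m x := mul_le_mul_of_nonneg_right (hQx.trans hχ'x) (hm0 x).le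
  refine ⟨ψ, χ, exhaustionCutoff s a, hψs, hψ0, hψz, hχs, hχ0, hχa, fun x ↦ (hkey x).1, fun x v ↦ ?_,
    contMDiff_exhaustionCutoff hs a, hasCompactSupport_exhaustionCutoff hsK a, exhaustionCutoff_mem_Icc a,
    eventually_exhaustionCutoff_eq_one hs a, sum_norm_dbar_exhaustionCutoff_sq_le_exp hs hCσ hCσ' a⟩
  -- the Levi bound of `φ' = φ + χ(s)`
  have hsum : (∑ j, ∑ k, del (Pi.single j 1) (dbar (Pi.single k 1) (fun z ↦ ((φ z + χ (s z) : ℝ) : ℂ))) x * v j * conj (v k)).re =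
      (∑ j, ∑ k, del (Pi.single j 1) (dbar (Pi.single k 1) (fun z ↦ (φ z : ℂ))) x * v j * conj (v k)).re +
        (∑ j, ∑ k, del (Pi.single j 1) (dbar (Pi.single k 1) (fun z ↦ (χ (s z) : ℂ))) x * v j * conj (v k)).re := by
    rw [← add_re, ← Finset.sum_add_distrib]
    congr 1
    refine Finset.sum_congr rfl fun j _ ↦ ?_
    rw [← Finset.sum_add_distrib]
    refine Finset.sum_congr rfl fun k _ ↦ ?_
    have : (fun z ↦ ((φ z + χ (s z) : ℝ) : ℂ)) = fun z ↦ (φ z : ℂ) + (χ (s z) : ℂ) := by funext z; push_cast; rfl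
    rw [this, del_dbar_add (contMDiff_ofReal hφ) (contMDiff_ofReal (contMDiff_comp_real hχs hs))]
    ring
  rw [hsum]
  have h1 := hLevi x v
  have h2 := mul_re_levi_le_re_levi_comp hχs hχ2 hs x v
  have h3 := hsLevi x v
  have h4 := (hkey x).2
  have hv : 0 ≤ ∑ j, ‖v j‖ ^ 2 := Finset.sum_nonneg fun j _ ↦ sq_nonneg _
  have h5 : deriv χ (s x) * (m x * ∑ j, ‖v j‖ ^ 2) ≤
      deriv χ (s x) * (∑ j, ∑ k, del (Pi.single j 1) (dbar (Pi.single k 1) (fun z ↦ (s z : ℂ))) x * v j * conj (v k)).re :=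
    mul_le_mul_of_nonneg_left h3 (hχ1 _)
  nlinarith [mul_le_mul_of_nonneg_right h4 hv]

omit [DecidableEq ι] in
/-- Finite Cauchy–Schwarz for absolute values: `∑ |a_j| |b_j| ≤ √(∑ |a_j|²) √(∑ |b_j|²)`. [folklore] -/
theorem sum_norm_mul_norm_le_sqrt (a b : ι → ℂ) :
    ∑ j, ‖a j‖ * ‖b j‖ ≤ Real.sqrt (∑ j, ‖a j‖ ^ 2) * Real.sqrt (∑ j, ‖b j‖ ^ 2) := by
  rw [← Real.sqrt_mul (Finset.sum_nonneg fun j _ ↦ sq_nonneg _)]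
  refine Real.le_sqrt_of_sq_le ?_
  exact Finset.sum_mul_sq_le_sq_mul_sq Finset.univ (fun j ↦ ‖a j‖) (fun j ↦ ‖b j‖)

include hφ hs hsK hc hc0 hm hm0 hLevi hsLevi in
/-- **Existence at level `a`** (proof of Lemma 4.4.1, middle): with the weights of
`exists_level_weights` there is `u_a ∈ L²(D, e^{-φ₁})`, `φ₁ = φ + χ(s) - 2ψ`, with `∂̄ u_a = g` weakly
and `‖u_a‖_{φ₁} ≤ M`, `M² = 2 ∫ |g|² e^{-φ}/c` — from the closure estimate, Cauchy–Schwarz and the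
range theorem for the densely defined closed operator `T`. [cite: HormanderSCV1973, proof of Lemma 4.4.1 (p. 92); Lemma 4.1.1] -/
theorem exists_solution_level {g : ι → D → ℂ} (hg : ∀ j, IsTest (g j))
    (hclosed : ∀ (j k : ι) (x : D), dbar (Pi.single j 1) (g k) x = dbar (Pi.single k 1) (g j) x) (a : ℝ) :
    ∃ (u : D → ℂ) (θ : D → ℝ) (χ : ℝ → ℝ), Continuous θ ∧ Continuous χ ∧ (∀ r, 0 ≤ χ r) ∧ (∀ r ≤ a, χ r = 0) ∧
      (∀ x, s x ≤ a → θ x = φ x) ∧ (∀ x, θ x ≤ φ x + χ (s x)) ∧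
      MemLp u 2 (D.volW θ) ∧
      eLpNorm u 2 (D.volW θ) ≤ ENNReal.ofReal (Real.sqrt (2 * ∫ x, (∑ j, ‖g j x‖ ^ 2) * Real.exp (-φ x) / c x ∂D.vol)) ∧
      HasWeakDbar D u (fun x j ↦ g j x) := by
  obtain ⟨ψ, χ, η, hψs, hψ0, hψz, hχs, hχ0, hχa, hχψ, hLevi', hηs, hηc, hη01, hη1, hηψ⟩ :=
    exists_level_weights hφ hs hsK hm hm0 hLevi hsLevi a
  set φ' : D → ℝ := fun x ↦ φ x + χ (s x) with hφ'def
  have hφ's : ContMDiff 𝓘(ℝ, ι → ℂ) 𝓘(ℝ, ℝ) ∞ φ' := hφ.add (contMDiff_comp_real hχs hs)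
  set W : Weights D := hormanderWeights φ' ψ hφ's.continuous hψs.continuous with hW
  have hW1 : ContMDiff 𝓘(ℝ, ι → ℂ) 𝓘(ℝ, ℝ) ∞ W.φ₁ := hφ's.sub (contMDiff_const.mul hψs)
  have hW2 : ContMDiff 𝓘(ℝ, ι → ℂ) 𝓘(ℝ, ℝ) ∞ W.φ₂ := hφ's.sub hψs
  -- the closure estimate with `κ = c`
  set c' : D → ℝ := fun x ↦ c x + 2 * ∑ j, ‖del (Pi.single j 1) (fun y ↦ (ψ y : ℂ)) x‖ ^ 2 with hc'def
  have hc' : Continuous c' :=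
    hc.add (continuous_const.mul (continuous_finsetSum _ fun j _ ↦ ((contMDiff_del (contMDiff_ofReal hψs) _).continuous.norm).pow 2))
  have hest := Weights.hormander_estimate_of_mem_F hφ's hψs hc' hLevi' (κ := c) hc (fun x ↦ (hc0 x).le)
    (fun x ↦ by simp only [hc'def]; linarith) hηs hηc hη01 hη1 hηψ
  -- `G = g ∈ F`
  have hGF : W.testForm hg ∈ W.F := by
    rw [mem_F_iff]
    have h0 := hasWeakDbarForm_of_contMDiff (D := D) (f := fun x j ↦ g j x) fun j ↦ (hg j).contMDiff
    have h1 : (fun (x : D) (j k : ι) ↦ dbar (Pi.single j 1) (fun y ↦ g k y) x - dbar (Pi.single k 1) (fun y ↦ g j y) x) =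
        fun _ _ _ ↦ 0 := by
      funext x j k
      have := hclosed j k x
      simp only [show (fun y ↦ g k y) = g k from rfl, show (fun y ↦ g j y) = g j from rfl, this, sub_self]
    rw [h1] at h0
    exact h0.congr_ae (fun j ↦ (coeFn_testForm hg j).symm) fun _ _ ↦ EventuallyEq.rfl
  -- the Cauchy–Schwarz estimate `|(g, f)_{φ₂}| ≤ M ‖T* f‖`
  set Ig : ℝ := ∫ x, (∑ j, ‖g j x‖ ^ 2) * Real.exp (-φ x) / c x ∂D.vol with hIg
  have hIg0 : 0 ≤ Ig := integral_nonneg fun x ↦ by have := hc0 x; positivity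
  set M : ℝ := Real.sqrt (2 * Ig) with hM
  have hMest : ∀ f : W.T†.domain, (f : W.H2) ∈ W.F → ‖⟪W.testForm hg, (f : W.H2)⟫_ℂ‖ ≤ M * ‖W.T† f‖ := by
    intro f hfF
    obtain ⟨hint, hle⟩ := hest f hfF
    set fF : ι → D → ℂ := fun j ↦ (((f : W.H2) j : Lp ℂ 2 W.μ₂) : D → ℂ) with hfF'
    -- the two Cauchy–Schwarz factors
    set F₁ : D → ℝ := fun x ↦ Real.exp (-W.φ₂ x + φ' x / 2) * Real.sqrt (∑ j, ‖g j x‖ ^ 2) * (Real.sqrt (c x))⁻¹ with hF₁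
    set F₂ : D → ℝ := fun x ↦ Real.sqrt (c x) * Real.sqrt (∑ j, ‖fF j x‖ ^ 2) * Real.exp (-φ' x / 2) with hF₂
    have hF₁0 : ∀ x, 0 ≤ F₁ x := fun x ↦ by positivity
    have hF₂0 : ∀ x, 0 ≤ F₂ x := fun x ↦ by positivity
    have hGsum : Continuous fun x ↦ ∑ j, ‖g j x‖ ^ 2 := continuous_finsetSum _ fun j _ ↦ ((hg j).continuous.norm).pow 2
    have hGsum0 : ∀ x ∉ ⋃ j, tsupport (g j), ∑ j, ‖g j x‖ ^ 2 = 0 := fun x hx ↦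
      Finset.sum_eq_zero fun j _ ↦ by rw [(eq_zero_of_notMem_iUnion_tsupport hx j 0).1, norm_zero]; ring
    have hF₁c : Continuous F₁ :=
      ((Real.continuous_exp.comp (W.continuous₂.neg.add (hφ's.continuous.div_const _))).mul
        (Real.continuous_sqrt.comp hGsum)).mul ((Real.continuous_sqrt.comp hc).inv₀ fun x ↦ (Real.sqrt_pos.2 (hc0 x)).ne')
    have hF₁s : HasCompactSupport F₁ :=
      HasCompactSupport.intro' (isCompact_iUnion_tsupport hg) (isClosed_iUnion_of_finite fun j ↦ isClosed_tsupport _)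
        fun x hx ↦ by simp only [hF₁, hGsum0 x hx, Real.sqrt_zero, mul_zero, zero_mul]
    have hF₁m : MemLp F₁ 2 D.vol := hF₁c.memLp_of_hasCompactSupport hF₁s
    have hF₂sq : ∀ x, F₂ x ^ 2 = c x * (∑ j, ‖fF j x‖ ^ 2) * Real.exp (-φ' x) := fun x ↦ by
      have hE : Real.exp (-φ' x / 2) ^ 2 = Real.exp (-φ' x) := by
        rw [← Real.exp_nat_mul]; congr 1; push_cast; ring
      simp only [hF₂, mul_pow, Real.sq_sqrt (hc0 x).le, Real.sq_sqrt (Finset.sum_nonneg fun j _ ↦ sq_nonneg _), hE]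
    have hF₂meas : AEStronglyMeasurable F₂ D.vol := by
      refine (((hc.measurable.sqrt).mul (Measurable.sqrt (Finset.measurable_sum _ fun j _ ↦ ?_))).mul
        (Real.measurable_exp.comp (hφ's.continuous.measurable.neg.div_const _))).aestronglyMeasurable
      exact (Lp.stronglyMeasurable _).measurable.norm.pow_const _
    have hF₂m : MemLp F₂ 2 D.vol := by
      rw [memLp_two_iff_integrable_sq hF₂meas]
      exact hint.congr (ae_of_all _ fun x ↦ (hF₂sq x).symm)
    -- `∫ F₁² ≤ Ig`
    have hF₁sq_le : ∀ x, F₁ x ^ 2 ≤ (∑ j, ‖g j x‖ ^ 2) * Real.exp (-φ x) / c x := fun x ↦ by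
      have hE : Real.exp (-W.φ₂ x + φ' x / 2) ^ 2 = Real.exp (-2 * W.φ₂ x + φ' x) := by
        rw [← Real.exp_nat_mul]; congr 1; push_cast; ring
      have h2 : F₁ x ^ 2 = (∑ j, ‖g j x‖ ^ 2) * Real.exp (-2 * W.φ₂ x + φ' x) / c x := by
        simp only [hF₁, mul_pow, inv_pow, Real.sq_sqrt (hc0 x).le, Real.sq_sqrt (Finset.sum_nonneg fun j _ ↦ sq_nonneg _), hE]
        rw [div_eq_mul_inv]; ring
      rw [h2]
      refine div_le_div_of_nonneg_right (mul_le_mul_of_nonneg_left (Real.exp_le_exp.2 ?_) (Finset.sum_nonneg fun j _ ↦ sq_nonneg _)) (hc0 x).le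
      have := hχψ x
      simp only [hW, hormanderWeights_φ₂, hφ'def]
      linarith
    have hIgint : Integrable (fun x ↦ (∑ j, ‖g j x‖ ^ 2) * Real.exp (-φ x) / c x) D.vol := by
      refine Continuous.integrable_of_hasCompactSupport ((hGsum.mul (Real.continuous_exp.comp hφ.continuous.neg)).div hc
        fun x ↦ (hc0 x).ne') ?_
      exact HasCompactSupport.intro' (isCompact_iUnion_tsupport hg) (isClosed_iUnion_of_finite fun j ↦ isClosed_tsupport _)
        fun x hx ↦ by simp only [hGsum0 x hx, zero_mul, zero_div]
    have hI₁ : ∫ x, F₁ x ^ 2 ∂D.vol ≤ Ig :=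
      integral_mono_of_nonneg (ae_of_all _ fun x ↦ sq_nonneg _) hIgint (ae_of_all _ hF₁sq_le)
    have hI₂ : ∫ x, F₂ x ^ 2 ∂D.vol ≤ 2 * ‖W.T† f‖ ^ 2 := by
      rw [integral_congr_ae (ae_of_all _ hF₂sq)]; exact hle
    -- pointwise: `‖e^{-φ₂} ∑ conj(g_j) f_j‖ ≤ F₁ F₂`
    have hpt : ∀ x, ∑ j, ‖(Real.exp (-W.φ₂ x) : ℂ) * (conj (g j x) * fF j x)‖ ≤ F₁ x * F₂ x := by
      intro x
      have e1 : ∑ j, ‖(Real.exp (-W.φ₂ x) : ℂ) * (conj (g j x) * fF j x)‖ = Real.exp (-W.φ₂ x) * ∑ j, ‖g j x‖ * ‖fF j x‖ := by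
        rw [Finset.mul_sum]
        exact Finset.sum_congr rfl fun j _ ↦ by rw [norm_mul, norm_mul, norm_real, Real.norm_of_nonneg (Real.exp_pos _).le, norm_conj]
      have e2 : F₁ x * F₂ x = Real.exp (-W.φ₂ x) * (Real.sqrt (∑ j, ‖g j x‖ ^ 2) * Real.sqrt (∑ j, ‖fF j x‖ ^ 2)) := by
        have hcx : Real.sqrt (c x) ≠ 0 := (Real.sqrt_pos.2 (hc0 x)).ne'
        have hE : Real.exp (-W.φ₂ x + φ' x / 2) * Real.exp (-φ' x / 2) = Real.exp (-W.φ₂ x) := by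
          rw [← Real.exp_add]; congr 1; ring
        calc F₁ x * F₂ x = (Real.exp (-W.φ₂ x + φ' x / 2) * Real.exp (-φ' x / 2)) * ((Real.sqrt (c x))⁻¹ * Real.sqrt (c x)) *
              (Real.sqrt (∑ j, ‖g j x‖ ^ 2) * Real.sqrt (∑ j, ‖fF j x‖ ^ 2)) := by simp only [hF₁, hF₂]; ring
          _ = _ := by rw [hE, inv_mul_cancel₀ hcx, mul_one]
      rw [e1, e2]
      exact mul_le_mul_of_nonneg_left (sum_norm_mul_norm_le_sqrt _ _) (Real.exp_pos _).le
    -- assemble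
    have hterm : ∀ j, Integrable (fun x ↦ (Real.exp (-W.φ₂ x) : ℂ) * (conj (g j x) * fF j x)) D.vol := fun j ↦ by
      have := integrable_mul_mul_weight W.continuous₂ (Lp.memLp ((f : W.H2) j)) (hg j).conj.continuous
        ((hg j).hasCompactSupport.comp_left (g := conj) (map_zero _))
      exact this.congr (ae_of_all _ fun x ↦ by simp only [hfF']; ring)
    calc ‖⟪W.testForm hg, (f : W.H2)⟫_ℂ‖
        = ‖∑ j, ∫ x, (Real.exp (-W.φ₂ x) : ℂ) * (conj (g j x) * fF j x) ∂D.vol‖ := by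
          rw [inner_H2]
          congr 1
          refine Finset.sum_congr rfl fun j _ ↦ integral_congr_ae ?_
          filter_upwards [coeFn_testForm (W := W) hg j] with x hx
          rw [hx]
      _ ≤ ∑ j, ‖∫ x, (Real.exp (-W.φ₂ x) : ℂ) * (conj (g j x) * fF j x) ∂D.vol‖ := norm_sum_le _ _
      _ ≤ ∑ j, ∫ x, ‖(Real.exp (-W.φ₂ x) : ℂ) * (conj (g j x) * fF j x)‖ ∂D.vol :=
          Finset.sum_le_sum fun j _ ↦ norm_integral_le_integral_norm _
      _ = ∫ x, ∑ j, ‖(Real.exp (-W.φ₂ x) : ℂ) * (conj (g j x) * fF j x)‖ ∂D.vol :=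
          (integral_finsetSum _ fun j _ ↦ (hterm j).norm).symm
      _ ≤ ∫ x, F₁ x * F₂ x ∂D.vol :=
          integral_mono_of_nonneg (ae_of_all _ fun x ↦ Finset.sum_nonneg fun j _ ↦ norm_nonneg _)
            (hF₁m.integrable_mul hF₂m) (ae_of_all _ hpt)
      _ ≤ (∫ x, F₁ x ^ (2 : ℝ) ∂D.vol) ^ (1 / (2 : ℝ)) * (∫ x, F₂ x ^ (2 : ℝ) ∂D.vol) ^ (1 / (2 : ℝ)) :=
          integral_mul_le_Lp_mul_Lq_of_nonneg Real.HolderConjugate.two_two (ae_of_all _ hF₁0) (ae_of_all _ hF₂0)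
            (by simpa using hF₁m) (by simpa using hF₂m)
      _ = Real.sqrt (∫ x, F₁ x ^ 2 ∂D.vol) * Real.sqrt (∫ x, F₂ x ^ 2 ∂D.vol) := by
          simp only [Real.rpow_two, Real.sqrt_eq_rpow]
      _ ≤ Real.sqrt Ig * Real.sqrt (2 * ‖W.T† f‖ ^ 2) :=
          mul_le_mul (Real.sqrt_le_sqrt hI₁) (Real.sqrt_le_sqrt hI₂) (Real.sqrt_nonneg _) (Real.sqrt_nonneg _)
      _ = M * ‖W.T† f‖ := by
          rw [hM, Real.sqrt_mul zero_le_two, Real.sqrt_mul zero_le_two, Real.sqrt_sq (norm_nonneg _)]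
          ring
  -- the range theorem
  obtain ⟨U, hUM, hU⟩ := Literature.Analysis.InnerProduct.exists_weak_solution_of_adjoint_inner_estimate (T := W.T)
    (dense_domT (W := W)) (F := W.F) isClosed_F (fun v ↦ T_mem_F v) hGF (Real.sqrt_nonneg _) hMest
  -- the weak equation `∂̄ U = g`
  have hweak : HasWeakDbar D (U : D → ℂ) (fun x j ↦ g j x) := by
    refine ⟨locallyIntegrable_H1 U, fun j ↦ locallyIntegrable_of_continuous (hg j).continuous, fun j w hw ↦ ?_⟩
    -- the test form `F = (0, …, e^{φ₂} w̄, …, 0)`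
    set h : D → ℂ := fun x ↦ (Real.exp (W.φ₂ x) : ℂ) * conj (w x) with hh
    have hh' : IsTest h := hw.conj.mul_left (contMDiff_ofReal (contMDiff_exp hW2))
    set Fj : ι → D → ℂ := Pi.single j h with hFj
    have hFj' : ∀ i, IsTest (Fj i) := fun i ↦ by
      by_cases hi : i = j
      · subst hi; simpa [hFj] using hh'
      · simp only [hFj, Pi.single_eq_of_ne hi]; exact IsTest.zero
    obtain ⟨hmem, hadj⟩ := adjoint_testForm hW1 hW2 hFj'
    have key := hU ⟨W.testForm hFj', hmem⟩
    rw [hadj, inner_H1, inner_H2] at key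
    -- conjugate both sides
    have key' := congrArg conj key
    rw [← integral_conj, _root_.map_sum] at key'
    simp_rw [← integral_conj, map_mul, conj_conj, conj_ofReal] at key'
    -- left side: `∫ e^{-φ₁} U conj(ϑ F) = -∫ U ∂̄_j w`
    have hL : ∫ x, (Real.exp (-W.φ₁ x) : ℂ) * ((U : D → ℂ) x * conj ((W.testFn (isTest_formalAdjoint hW1 hW2 hFj') : D → ℂ) x)) ∂D.vol =
        -∫ x, (U : D → ℂ) x * dbar (Pi.single j 1) w x ∂D.vol := by
      rw [← MeasureTheory.integral_neg]
      refine integral_congr_ae ?_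
      filter_upwards [coeFn_testFn (W := W) (isTest_formalAdjoint hW1 hW2 hFj')] with x hx
      rw [hx]
      have hid := exp_mul_conj_formalAdjoint (W := W) hW2 hFj' x
      have hsum : ∑ i, dbar (Pi.single i 1) (fun y ↦ conj (Fj i y) * (Real.exp (-W.φ₂ y) : ℂ)) x = dbar (Pi.single j 1) w x := by
        rw [Finset.sum_eq_single j (fun i _ hi ↦ ?_) (fun h ↦ (h (Finset.mem_univ _)).elim)]
        · congr 1
          funext y
          simp only [hFj, Pi.single_eq_same, hh, map_mul, conj_ofReal, conj_conj]
          rw [mul_assoc, mul_comm (w y), ← mul_assoc, ← ofReal_mul, ← Real.exp_add, add_neg_cancel, Real.exp_zero, ofReal_one, one_mul]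
        · have : (fun y ↦ conj (Fj i y) * (Real.exp (-W.φ₂ y) : ℂ)) = 0 := by
            funext y; simp [hFj, Pi.single_eq_of_ne hi]
          rw [this]
          exact dbar_const _ _ (c := (0 : ℂ))
      rw [hsum] at hid
      calc (Real.exp (-W.φ₁ x) : ℂ) * ((U : D → ℂ) x * conj (W.formalAdjoint Fj x))
          = (U : D → ℂ) x * ((Real.exp (-W.φ₁ x) : ℂ) * conj (W.formalAdjoint Fj x)) := by ring
        _ = -((U : D → ℂ) x * dbar (Pi.single j 1) w x) := by rw [hid]; ring
    -- right side: `∑_i ∫ e^{-φ₂} G_i conj(F_i) = ∫ g_j w`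
    have hR : ∑ i, ∫ x, (Real.exp (-W.φ₂ x) : ℂ) * (((W.testForm hg i : Lp ℂ 2 W.μ₂) : D → ℂ) x *
        conj (((W.testForm hFj' i : Lp ℂ 2 W.μ₂) : D → ℂ) x)) ∂D.vol = ∫ x, g j x * w x ∂D.vol := by
      rw [Finset.sum_eq_single j (fun i _ hi ↦ ?_) (fun h ↦ (h (Finset.mem_univ _)).elim)]
      · refine integral_congr_ae ?_
        filter_upwards [coeFn_testForm (W := W) hg j, coeFn_testForm (W := W) hFj' j] with x hx1 hx2
        rw [hx1, hx2]
        simp only [hFj, Pi.single_eq_same, hh, map_mul, conj_ofReal, conj_conj]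
        rw [show (Real.exp (-W.φ₂ x) : ℂ) * (g j x * ((Real.exp (W.φ₂ x) : ℂ) * w x)) =
          ((Real.exp (-W.φ₂ x) : ℂ) * (Real.exp (W.φ₂ x) : ℂ)) * (g j x * w x) by ring, ← ofReal_mul, ← Real.exp_add,
          neg_add_cancel, Real.exp_zero, ofReal_one, one_mul]
      · refine integral_eq_zero_of_ae ?_
        filter_upwards [coeFn_testForm (W := W) hFj' i] with x hx
        rw [hx]
        simp [hFj, Pi.single_eq_of_ne hi]
    rw [hL, hR] at key'
    rw [← key', neg_neg]
  -- package
  refine ⟨(U : D → ℂ), W.φ₁, χ, W.continuous₁, hχs.continuous, hχ0, hχa, fun x hx ↦ ?_, fun x ↦ ?_, Lp.memLp U, ?_, hweak⟩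
  · simp only [hW, hormanderWeights_φ₁, hφ'def]
    rw [hχa _ hx, hψz x (by linarith)]; ring
  · simp only [hW, hormanderWeights_φ₁, hφ'def]
    linarith [hψ0 x]
  · rw [← ENNReal.ofReal_toReal (Lp.eLpNorm_ne_top U), ← Lp.norm_def]
    exact ENNReal.ofReal_le_ofReal hUM

end Level


/-! ### The limit `a → ∞` -/

section Limit

open Weights

omit [DecidableEq ι] in
/-- `∫⁻ ofReal(|u|² e^{-φ}) d vol = ∫⁻ ‖u‖ₑ² d(e^{-φ} vol)`. [folklore] -/
theorem lintegral_ofReal_norm_sq_mul_exp {φ : D → ℝ} (hφ : Continuous φ) (u : D → ℂ) :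
    ∫⁻ x, ENNReal.ofReal (‖u x‖ ^ 2 * Real.exp (-φ x)) ∂D.vol = ∫⁻ x, ‖u x‖ₑ ^ 2 ∂D.volW φ := by
  rw [volW, lintegral_withDensity_eq_lintegral_mul_non_measurable _ (measurable_coe_weight hφ)
    (Eventually.of_forall fun x ↦ ENNReal.coe_lt_top)]
  refine lintegral_congr fun x ↦ ?_
  rw [Pi.mul_apply, ← ENNReal.ofReal_coe_nnreal, coe_weight, ENNReal.ofReal_mul (sq_nonneg _), ← ofReal_norm,
    ENNReal.ofReal_pow (norm_nonneg _), mul_comm]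

omit [DecidableEq ι] in
/-- From `‖u‖_{L²(e^{-φ})} ≤ M` to `∫⁻ |u|² e^{-φ} ≤ M²`. [folklore] -/
theorem lintegral_le_of_eLpNorm_le {φ : D → ℝ} (hφ : Continuous φ) {u : D → ℂ} {M : ℝ} (hM : 0 ≤ M)
    (h : eLpNorm u 2 (D.volW φ) ≤ ENNReal.ofReal M) :
    ∫⁻ x, ENNReal.ofReal (‖u x‖ ^ 2 * Real.exp (-φ x)) ∂D.vol ≤ ENNReal.ofReal (M ^ 2) := by
  rw [lintegral_ofReal_norm_sq_mul_exp hφ]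
  rw [FluidPDE.eLpNorm_two_eq_rpow] at h
  have := ENNReal.rpow_le_rpow h (z := 2) zero_le_two
  rw [← ENNReal.rpow_mul, show (1 / 2 : ℝ) * 2 = 1 by norm_num, ENNReal.rpow_one] at this
  refine this.trans_eq ?_
  rw [ENNReal.ofReal_pow hM, ENNReal.rpow_two]

omit [DecidableEq ι] in
/-- Weighted `L²` membership from a finite `∫⁻ |u|² e^{-φ}`. [folklore] -/
theorem memLp_two_volW_of_lintegral_lt_top {φ : D → ℝ} (hφ : Continuous φ) {u : D → ℂ} (hu : AEStronglyMeasurable u D.vol)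
    (h : ∫⁻ x, ENNReal.ofReal (‖u x‖ ^ 2 * Real.exp (-φ x)) ∂D.vol < ⊤) : MemLp u 2 (D.volW φ) := by
  rw [memLp_two_volW_iff hφ hu]
  refine ⟨(hu.norm.pow 2).mul (Real.continuous_exp.comp hφ.neg).aestronglyMeasurable, ?_⟩
  rw [hasFiniteIntegral_iff_enorm]
  refine lt_of_le_of_lt (le_of_eq (lintegral_congr fun x ↦ ?_)) h
  rw [Real.enorm_eq_ofReal (by positivity)]

/-- A locally finite sum of continuous functions vanishing on `(-∞, a]` is continuous and dominates
each term. [folklore] -/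
theorem continuous_tsum_of_eq_zero {χ : ℕ → ℝ → ℝ} (hχc : ∀ a, Continuous (χ a)) (hχ0 : ∀ (a : ℕ) (r : ℝ), r ≤ a → χ a r = 0) :
    Continuous fun r ↦ ∑' a : ℕ, χ a r := by
  refine continuous_iff_continuousAt.2 fun r₀ ↦ ?_
  have hN : r₀ < ((⌈r₀⌉₊ + 1 : ℕ) : ℝ) := by push_cast; linarith [Nat.le_ceil r₀]
  have hev : (fun r ↦ ∑ a ∈ Finset.range (⌈r₀⌉₊ + 1), χ a r) =ᶠ[𝓝 r₀] fun r ↦ ∑' a : ℕ, χ a r := by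
    filter_upwards [Iio_mem_nhds hN] with r hr
    refine (tsum_eq_sum fun a ha ↦ hχ0 a r ?_).symm
    rw [Finset.mem_range, not_lt] at ha
    exact hr.le.trans (by exact_mod_cast ha)
  exact ((continuous_finsetSum _ fun a _ ↦ hχc a).continuousAt).congr hev

omit [Fintype ι] [DecidableEq ι] in
/-- Each term is dominated by the locally finite sum (nonnegative terms). [folklore] -/
theorem le_tsum_of_eq_zero {χ : ℕ → ℝ → ℝ} (hχp : ∀ a r, 0 ≤ χ a r) (hχ0 : ∀ (a : ℕ) (r : ℝ), r ≤ a → χ a r = 0)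
    (a : ℕ) (r : ℝ) : χ a r ≤ ∑' b : ℕ, χ b r := by
  have hs : Summable fun b : ℕ ↦ χ b r := by
    refine summable_of_ne_finset_zero (s := Finset.range (⌈r⌉₊ + 1)) fun b hb ↦ hχ0 b r ?_
    rw [Finset.mem_range, not_lt] at hb
    have : (⌈r⌉₊ : ℝ) + 1 ≤ b := by exact_mod_cast hb
    linarith [Nat.le_ceil r]
  exact hs.le_tsum a fun b _ ↦ hχp b r

/-- **Weak limits of bounded families of weak solutions** (the limiting step of the proof of
Lemma 4.4.1, abstract form). Let `v_k ∈ L²(D, e^{-Φ})` with `‖v_k‖ ≤ M` solve `∂̄ v_k = g` weakly, and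
let `w_{k₀} ≥ 0` be measurable weights with `w_{k₀} ≤ C_{k₀} e^{-Φ}` and
`∫ |v_k|² w_{k₀} ≤ M²` for all large `k`. Then some `V ∈ L²(D, e^{-Φ})`, `‖V‖ ≤ M`, solves `∂̄ V = g`
weakly and satisfies `∫ |V|² w_{k₀} ≤ M²` for every `k₀` (weak limit along an ultrafilter via the Riesz
representation; weak lower semicontinuity tested against `w_{k₀} e^{Φ} V`).
[cite: HormanderSCV1973, proof of Lemma 4.4.1 (p. 92, «weak limit … when a → ∞»)] -/
theorem exists_weak_limit {Φ : D → ℝ} (hΦc : Continuous Φ) {g : D → ι → ℂ}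
    (hgl : ∀ j, LocallyIntegrable (fun x ↦ g x j) D.vol)
    {v : ℕ → D → ℂ} (hmem : ∀ k, MemLp (v k) 2 (D.volW Φ)) {M : ℝ} (hM0 : 0 ≤ M)
    (hnorm : ∀ k, eLpNorm (v k) 2 (D.volW Φ) ≤ ENNReal.ofReal M) (hweak : ∀ k, HasWeakDbar D (v k) g)
    {w : ℕ → D → ℝ} (hwm : ∀ k₀, Measurable (w k₀)) (hw0 : ∀ k₀ x, 0 ≤ w k₀ x)
    (hwC : ∀ k₀, ∃ C, 0 ≤ C ∧ ∀ x, w k₀ x ≤ C * Real.exp (-Φ x))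
    (hvw : ∀ k₀, ∀ᶠ k in atTop, ∫⁻ x, ENNReal.ofReal (‖v k x‖ ^ 2 * w k₀ x) ∂D.vol ≤ ENNReal.ofReal (M ^ 2)) :
    ∃ V : D → ℂ, MemLp V 2 (D.volW Φ) ∧ eLpNorm V 2 (D.volW Φ) ≤ ENNReal.ofReal M ∧ HasWeakDbar D V g ∧
      ∀ k₀, ∫⁻ x, ENNReal.ofReal (‖V x‖ ^ 2 * w k₀ x) ∂D.vol ≤ ENNReal.ofReal (M ^ 2) := by
  set Ua : ℕ → Lp ℂ 2 (D.volW Φ) := fun a ↦ (hmem a).toLp (v a) with hUa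
  have hUa_ae : ∀ a, (Ua a : D → ℂ) =ᵐ[D.vol] v a := fun a ↦ (eventuallyEq_volW_iff hΦc).1 (MemLp.coeFn_toLp _)
  have hUa_norm : ∀ a, ‖Ua a‖ ≤ M := fun a ↦ by
    rw [hUa, Lp.norm_toLp]
    exact ENNReal.toReal_le_of_le_ofReal hM0 (hnorm a)
  -- weak limit along an ultrafilter, via the Riesz representation
  set 𝒰 : Ultrafilter ℕ := Ultrafilter.of atTop with h𝒰
  have h𝒰le : (𝒰 : Filter ℕ) ≤ atTop := Ultrafilter.of_le _
  have hlim : ∀ z : Lp ℂ 2 (D.volW Φ), ∃ ℓz : ℂ, ℓz ∈ Metric.closedBall (0 : ℂ) (M * ‖z‖) ∧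
      Tendsto (fun a ↦ ⟪Ua a, z⟫_ℂ) 𝒰 (𝓝 ℓz) := by
    intro z
    have hle : ((𝒰.map fun a ↦ ⟪Ua a, z⟫_ℂ : Ultrafilter ℂ) : Filter ℂ) ≤ 𝓟 (Metric.closedBall 0 (M * ‖z‖)) := by
      rw [Ultrafilter.coe_map, le_principal_iff, Filter.mem_map]
      refine univ_mem' fun a ↦ ?_
      rw [mem_preimage, Metric.mem_closedBall, dist_zero_right]
      exact (norm_inner_le_norm _ _).trans (mul_le_mul_of_nonneg_right (hUa_norm a) (norm_nonneg _))
    obtain ⟨ℓz, hz, hzle⟩ := (isCompact_closedBall (0 : ℂ) (M * ‖z‖)).ultrafilter_le_nhds _ hle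
    exact ⟨ℓz, hz, by rw [Ultrafilter.coe_map] at hzle; exact hzle⟩
  choose ℓ hℓball hℓlim using hlim
  have hℓadd : ∀ z z', ℓ (z + z') = ℓ z + ℓ z' := fun z z' ↦
    tendsto_nhds_unique (hℓlim (z + z')) (by simpa only [inner_add_right] using (hℓlim z).add (hℓlim z'))
  have hℓsmul : ∀ (k : ℂ) z, ℓ (k • z) = k * ℓ z := fun k z ↦
    tendsto_nhds_unique (hℓlim _) (by simpa only [inner_smul_right] using (hℓlim z).const_mul k)
  have hℓbd : ∀ z, ‖ℓ z‖ ≤ M * ‖z‖ := fun z ↦ by simpa only [Metric.mem_closedBall, dist_zero_right] using hℓball z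
  set Lℓ : Lp ℂ 2 (D.volW Φ) →L[ℂ] ℂ := LinearMap.mkContinuous ⟨⟨ℓ, hℓadd⟩, hℓsmul⟩ M hℓbd with hLℓ
  set U : Lp ℂ 2 (D.volW Φ) := (InnerProductSpace.toDual ℂ (Lp ℂ 2 (D.volW Φ))).symm Lℓ with hU
  have hUinner : ∀ z, ⟪U, z⟫_ℂ = ℓ z := fun z ↦ by
    rw [hU, InnerProductSpace.toDual_symm_apply]; rfl
  have hUnormle : ‖U‖ ≤ M := by
    rw [hU, LinearIsometryEquiv.norm_map]
    exact LinearMap.mkContinuous_norm_le _ hM0 _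
  -- the weak equation passes to the limit
  have hweakU : HasWeakDbar D (U : D → ℂ) g := by
    refine ⟨locallyIntegrable_of_memLp_two_volW hΦc (Lp.memLp U), hgl, fun j w' hw' ↦ ?_⟩
    obtain ⟨z, hz⟩ := exists_integral_mul_eq_inner hΦc ((hw'.dbar (Pi.single j 1)).continuous)
      ((hw'.dbar (Pi.single j 1)).hasCompactSupport)
    have hconst : ∀ a, conj ⟪Ua a, z⟫_ℂ = -∫ x, g x j * w' x ∂D.vol := fun a ↦ by
      rw [inner_conj_symm, ← hz (Ua a), ← (hweak a).integral_eq j w' hw']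
      exact integral_congr_ae (by filter_upwards [hUa_ae a] with x hx; rw [hx])
    have h1 : Tendsto (fun a ↦ conj ⟪Ua a, z⟫_ℂ) 𝒰 (𝓝 (conj (ℓ z))) := (continuous_conj.tendsto _).comp (hℓlim z)
    have h2 : conj (ℓ z) = -∫ x, g x j * w' x ∂D.vol :=
      tendsto_nhds_unique h1 (by simp only [hconst]; exact tendsto_const_nhds)
    rw [hz U, ← inner_conj_symm, hUinner, h2]
  have hUmeas : AEStronglyMeasurable (U : D → ℂ) D.vol := aestronglyMeasurable_of_memLp_volW hΦc (Lp.memLp U)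
  refine ⟨(U : D → ℂ), Lp.memLp U, ?_, hweakU, fun k₀ ↦ ?_⟩
  · rw [← ENNReal.ofReal_toReal (Lp.eLpNorm_ne_top U), ← Lp.norm_def]
    exact ENNReal.ofReal_le_ofReal hUnormle
  -- the bound `∫ |U|² w_{k₀} ≤ M²`
  obtain ⟨C, hC0, hC⟩ := hwC k₀
  -- the test vector `w e^{Φ} U`
  set vf : D → ℂ := fun x ↦ ((w k₀ x * Real.exp (Φ x) : ℝ) : ℂ) * (U : D → ℂ) x with hvf
  have hratio : ∀ x, w k₀ x * Real.exp (Φ x) ≤ C := fun x ↦ by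
    have := mul_le_mul_of_nonneg_right (hC x) (Real.exp_pos (Φ x)).le
    rwa [mul_assoc, ← Real.exp_add, neg_add_cancel, Real.exp_zero, mul_one] at this
  have hratio0 : ∀ x, 0 ≤ w k₀ x * Real.exp (Φ x) := fun x ↦ mul_nonneg (hw0 k₀ x) (Real.exp_pos _).le
  have hvf_meas : AEStronglyMeasurable vf D.vol :=
    ((continuous_ofReal.measurable.comp ((hwm k₀).mul (Real.measurable_exp.comp hΦc.measurable))).aestronglyMeasurable).mul hUmeas
  have hvf_mem : MemLp vf 2 (D.volW Φ) := by
    refine memLp_two_volW_of_le hΦc hΦc (C := C ^ 2) (Lp.memLp U) hvf_meas fun x ↦ ?_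
    simp only [hvf, norm_mul, norm_real, Real.norm_eq_abs, mul_pow]
    rw [show |w k₀ x| = w k₀ x from abs_of_nonneg (hw0 k₀ x), show |Real.exp (Φ x)| = Real.exp (Φ x) from abs_of_pos (Real.exp_pos _)]
    have h1 : (w k₀ x * Real.exp (Φ x)) ^ 2 ≤ C ^ 2 := pow_le_pow_left₀ (hratio0 x) (hratio x) 2
    have h1' : w k₀ x ^ 2 * Real.exp (Φ x) ^ 2 ≤ C ^ 2 := by rw [← mul_pow]; exact h1
    have h2 : 0 ≤ ‖(U : D → ℂ) x‖ ^ 2 * Real.exp (-Φ x) := by positivity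
    nlinarith [mul_le_mul_of_nonneg_right h1' h2]
  set vN : Lp ℂ 2 (D.volW Φ) := hvf_mem.toLp vf with hvN
  have hvN_ae : (vN : D → ℂ) =ᵐ[D.vol] vf := (eventuallyEq_volW_iff hΦc).1 (MemLp.coeFn_toLp _)
  -- `I := ∫ w |U|²` is finite
  set FN : D → ℝ := fun x ↦ ‖(U : D → ℂ) x‖ ^ 2 * w k₀ x with hFN
  have hFN0 : ∀ x, 0 ≤ FN x := fun x ↦ mul_nonneg (sq_nonneg _) (hw0 k₀ x)
  have hFNmeas : AEStronglyMeasurable FN D.vol := (hUmeas.norm.pow 2).mul (hwm k₀).aestronglyMeasurable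
  have hFNint : Integrable FN D.vol := by
    have hI := (memLp_two_volW_iff hΦc hUmeas).1 (Lp.memLp U)
    refine (hI.const_mul C).mono' hFNmeas (ae_of_all _ fun x ↦ ?_)
    rw [Real.norm_of_nonneg (hFN0 x), hFN]
    calc ‖(U : D → ℂ) x‖ ^ 2 * w k₀ x ≤ ‖(U : D → ℂ) x‖ ^ 2 * (C * Real.exp (-Φ x)) :=
          mul_le_mul_of_nonneg_left (hC x) (sq_nonneg _)
      _ = _ := by ring
  set IN : ℝ := ∫ x, FN x ∂D.vol with hINdef
  have hIN0 : 0 ≤ IN := integral_nonneg hFN0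
  -- `⟪U, v_N⟫ = I`
  have hUvN : ⟪U, vN⟫_ℂ = (IN : ℂ) := by
    rw [L2.inner_def, integral_volW_mul hΦc, hINdef, ← integral_complex_ofReal]
    refine integral_congr_ae ?_
    filter_upwards [hvN_ae] with x hx
    rw [RCLike.inner_apply', hx]
    simp only [hvf, hFN]
    rw [show (Real.exp (-Φ x) : ℂ) * (conj ((U : D → ℂ) x) * (((w k₀ x * Real.exp (Φ x) : ℝ) : ℂ) * (U : D → ℂ) x)) =
      ((Real.exp (-Φ x) : ℂ) * ((w k₀ x * Real.exp (Φ x) : ℝ) : ℂ)) * (conj ((U : D → ℂ) x) * (U : D → ℂ) x) by ring,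
      ← ofReal_mul, conj_mul', ← ofReal_pow, ← ofReal_mul]
    congr 1
    rw [show Real.exp (-Φ x) * (w k₀ x * Real.exp (Φ x)) = w k₀ x * (Real.exp (-Φ x) * Real.exp (Φ x)) by ring,
      ← Real.exp_add, neg_add_cancel, Real.exp_zero, mul_one, mul_comm]
  -- `|⟪U_a, v_N⟫| ≤ M √I` for the good `a`
  have hUavN : ∀ a : ℕ, ∫⁻ x, ENNReal.ofReal (‖v a x‖ ^ 2 * w k₀ x) ∂D.vol ≤ ENNReal.ofReal (M ^ 2) →
      ‖⟪Ua a, vN⟫_ℂ‖ ≤ M * Real.sqrt IN := by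
    intro a ha
    set A : D → ℝ := fun x ↦ ‖v a x‖ * Real.sqrt (w k₀ x) with hA
    set Bf : D → ℝ := fun x ↦ ‖(U : D → ℂ) x‖ * Real.sqrt (w k₀ x) with hBf
    have hA0 : ∀ x, 0 ≤ A x := fun x ↦ mul_nonneg (norm_nonneg _) (Real.sqrt_nonneg _)
    have hB0 : ∀ x, 0 ≤ Bf x := fun x ↦ mul_nonneg (norm_nonneg _) (Real.sqrt_nonneg _)
    have hua_meas : AEStronglyMeasurable (v a) D.vol := aestronglyMeasurable_of_memLp_volW hΦc (hmem a)
    have hsqw : AEStronglyMeasurable (fun x ↦ Real.sqrt (w k₀ x)) D.vol := (hwm k₀).sqrt.aestronglyMeasurable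
    have hmA : AEStronglyMeasurable A D.vol := hua_meas.norm.mul hsqw
    have hmB : AEStronglyMeasurable Bf D.vol := hUmeas.norm.mul hsqw
    have hmAsq : AEStronglyMeasurable (fun x ↦ ‖v a x‖ ^ 2 * w k₀ x) D.vol := (hua_meas.norm.pow 2).mul (hwm k₀).aestronglyMeasurable
    have hAsq : ∀ x, A x ^ 2 = ‖v a x‖ ^ 2 * w k₀ x := fun x ↦ by
      simp only [hA, mul_pow, Real.sq_sqrt (hw0 k₀ x)]
    have hBsq : ∀ x, Bf x ^ 2 = FN x := fun x ↦ by
      simp only [hBf, hFN, mul_pow, Real.sq_sqrt (hw0 k₀ x)]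
    have hAint : Integrable (fun x ↦ ‖v a x‖ ^ 2 * w k₀ x) D.vol := by
      refine ⟨hmAsq, ?_⟩
      rw [hasFiniteIntegral_iff_enorm]
      refine lt_of_le_of_lt (le_of_eq (lintegral_congr fun x ↦ ?_)) (ha.trans_lt ENNReal.ofReal_lt_top)
      rw [Real.enorm_eq_ofReal (mul_nonneg (sq_nonneg _) (hw0 k₀ x))]
    have hAm : MemLp A 2 D.vol := by
      rw [memLp_two_iff_integrable_sq hmA]
      exact hAint.congr (ae_of_all _ fun x ↦ (hAsq x).symm)
    have hBm : MemLp Bf 2 D.vol := by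
      rw [memLp_two_iff_integrable_sq hmB]
      exact hFNint.congr (ae_of_all _ fun x ↦ (hBsq x).symm)
    have hIA : ∫ x, A x ^ 2 ∂D.vol ≤ M ^ 2 := by
      rw [integral_congr_ae (ae_of_all _ hAsq),
        integral_eq_lintegral_of_nonneg_ae (ae_of_all _ fun x ↦ mul_nonneg (sq_nonneg _) (hw0 k₀ x)) hmAsq]
      have := ENNReal.toReal_mono ENNReal.ofReal_ne_top ha
      rwa [ENNReal.toReal_ofReal (sq_nonneg _)] at this
    have hIB : ∫ x, Bf x ^ 2 ∂D.vol = IN := integral_congr_ae (ae_of_all _ hBsq)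
    have hinner : ⟪Ua a, vN⟫_ℂ = ∫ x, ((w k₀ x : ℝ) : ℂ) * (conj (v a x) * (U : D → ℂ) x) ∂D.vol := by
      rw [L2.inner_def, integral_volW_mul hΦc]
      refine integral_congr_ae ?_
      filter_upwards [hvN_ae, hUa_ae a] with x hx hxa
      rw [RCLike.inner_apply', hx, hxa]
      simp only [hvf]
      rw [show (Real.exp (-Φ x) : ℂ) * (conj (v a x) * (((w k₀ x * Real.exp (Φ x) : ℝ) : ℂ) * (U : D → ℂ) x)) =
        ((Real.exp (-Φ x) : ℂ) * ((w k₀ x * Real.exp (Φ x) : ℝ) : ℂ)) * (conj (v a x) * (U : D → ℂ) x) by ring,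
        ← ofReal_mul]
      congr 2
      rw [show Real.exp (-Φ x) * (w k₀ x * Real.exp (Φ x)) = w k₀ x * (Real.exp (-Φ x) * Real.exp (Φ x)) by ring,
        ← Real.exp_add, neg_add_cancel, Real.exp_zero, mul_one]
    rw [hinner]
    calc ‖∫ x, ((w k₀ x : ℝ) : ℂ) * (conj (v a x) * (U : D → ℂ) x) ∂D.vol‖
        ≤ ∫ x, ‖((w k₀ x : ℝ) : ℂ) * (conj (v a x) * (U : D → ℂ) x)‖ ∂D.vol := norm_integral_le_integral_norm _
      _ = ∫ x, A x * Bf x ∂D.vol := integral_congr_ae (ae_of_all _ fun x ↦ by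
          simp only [hA, hBf, norm_mul, norm_real, Real.norm_eq_abs, abs_of_nonneg (hw0 k₀ x), norm_conj]
          calc w k₀ x * (‖v a x‖ * ‖(U : D → ℂ) x‖) = (Real.sqrt (w k₀ x) * Real.sqrt (w k₀ x)) * (‖v a x‖ * ‖(U : D → ℂ) x‖) := by
                rw [Real.mul_self_sqrt (hw0 k₀ x)]
            _ = _ := by ring)
      _ ≤ (∫ x, A x ^ (2 : ℝ) ∂D.vol) ^ (1 / (2 : ℝ)) * (∫ x, Bf x ^ (2 : ℝ) ∂D.vol) ^ (1 / (2 : ℝ)) :=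
          integral_mul_le_Lp_mul_Lq_of_nonneg Real.HolderConjugate.two_two (ae_of_all _ hA0) (ae_of_all _ hB0)
            (by simpa using hAm) (by simpa using hBm)
      _ = Real.sqrt (∫ x, A x ^ 2 ∂D.vol) * Real.sqrt (∫ x, Bf x ^ 2 ∂D.vol) := by
          simp only [Real.rpow_two, Real.sqrt_eq_rpow]
      _ ≤ Real.sqrt (M ^ 2) * Real.sqrt IN := by
          rw [hIB]; exact mul_le_mul_of_nonneg_right (Real.sqrt_le_sqrt hIA) (Real.sqrt_nonneg _)
      _ = M * Real.sqrt IN := by rw [Real.sqrt_sq hM0]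
  -- pass to the limit along `𝒰`: `I ≤ M √I`, hence `I ≤ M²`
  have hlimN : ‖(IN : ℂ)‖ ≤ M * Real.sqrt IN := by
    rw [← hUvN, hUinner]
    refine le_of_tendsto ((continuous_norm.tendsto _).comp (hℓlim vN)) ?_
    have hev : ∀ᶠ a in (𝒰 : Filter ℕ), ∫⁻ x, ENNReal.ofReal (‖v a x‖ ^ 2 * w k₀ x) ∂D.vol ≤ ENNReal.ofReal (M ^ 2) :=
      h𝒰le (hvw k₀)
    exact hev.mono fun a ha ↦ hUavN a ha
  have hINle : IN ≤ M ^ 2 := by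
    rw [norm_real, Real.norm_of_nonneg hIN0] at hlimN
    have hs' := Real.sqrt_nonneg IN
    have hsq := Real.sq_sqrt hIN0
    nlinarith [hlimN, hsq, hs', hM0]
  have hFNeq : ∀ x, ENNReal.ofReal (‖(U : D → ℂ) x‖ ^ 2 * w k₀ x) = ENNReal.ofReal (FN x) := fun x ↦ rfl
  rw [lintegral_congr hFNeq, ← ofReal_integral_eq_lintegral_ofReal hFNint (ae_of_all _ hFN0)]
  exact ENNReal.ofReal_le_ofReal hINle

variable {φ s : D → ℝ} (hφ : ContMDiff 𝓘(ℝ, ι → ℂ) 𝓘(ℝ, ℝ) ∞ φ) (hs : ContMDiff 𝓘(ℝ, ι → ℂ) 𝓘(ℝ, ℝ) ∞ s)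
  (hsK : ∀ b : ℝ, IsCompact {x | s x ≤ b})
  {c m : D → ℝ} (hc : Continuous c) (hc0 : ∀ x, 0 < c x) (hm : Continuous m) (hm0 : ∀ x, 0 < m x)
  (hLevi : ∀ (x : D) (v : ι → ℂ), c x * ∑ j, ‖v j‖ ^ 2 ≤
    (∑ j, ∑ k, del (Pi.single j 1) (dbar (Pi.single k 1) (fun z ↦ (φ z : ℂ))) x * v j * conj (v k)).re)
  (hsLevi : ∀ (x : D) (v : ι → ℂ), m x * ∑ j, ‖v j‖ ^ 2 ≤
    (∑ j, ∑ k, del (Pi.single j 1) (dbar (Pi.single k 1) (fun z ↦ (s z : ℂ))) x * v j * conj (v k)).re)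

include hφ hs hsK hc hc0 hm hm0 hLevi hsLevi in
/-- **Hörmander's Lemma 4.4.1 on a flat Riemann domain** (functions, `q = 0`). Let `D` carry a `C^∞`
exhaustion `s` (compact sublevel sets) with `∑ s_{jk̄} v_j v̄_k ≥ m |v|²`, `m > 0` continuous; let
`φ ∈ C^∞(D)` with `∑ φ_{jk̄} v_j v̄_k ≥ c |v|²`, `c > 0` continuous; let `g` be a smooth compactly
supported `(0,1)`-form with `∂̄ g = 0`. Then there is `u ∈ L²(D, e^{-φ})` with `∂̄ u = g` weakly and
`∫ |u|² e^{-φ} d vol ≤ 2 ∫ |g|² e^{-φ} / c d vol`. [cite: HormanderSCV1973, Lemma 4.4.1 (p. 92)] -/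
theorem hormander_existence {g : ι → D → ℂ} (hg : ∀ j, IsTest (g j))
    (hclosed : ∀ (j k : ι) (x : D), dbar (Pi.single j 1) (g k) x = dbar (Pi.single k 1) (g j) x) :
    ∃ u : D → ℂ, MemLp u 2 (D.volW φ) ∧ HasWeakDbar D u (fun x j ↦ g j x) ∧
      ∫ x, ‖u x‖ ^ 2 * Real.exp (-φ x) ∂D.vol ≤ 2 * ∫ x, (∑ j, ‖g j x‖ ^ 2) * Real.exp (-φ x) / c x ∂D.vol := by
  set Ig : ℝ := ∫ x, (∑ j, ‖g j x‖ ^ 2) * Real.exp (-φ x) / c x ∂D.vol with hIg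
  have hIg0 : 0 ≤ Ig := integral_nonneg fun x ↦ by have := hc0 x; positivity
  set M : ℝ := Real.sqrt (2 * Ig) with hM
  have hM0 : 0 ≤ M := Real.sqrt_nonneg _
  have hM2 : M ^ 2 = 2 * Ig := Real.sq_sqrt (by positivity)
  -- the level solutions
  choose u θ χ hθc hχc hχ0 hχa hθφ hθle hmem hnorm hweak using
    fun a : ℕ ↦ exists_solution_level hφ hs hsK hc hc0 hm hm0 hLevi hsLevi hg hclosed (a : ℝ)
  -- one big weighted space containing all `u_a` in its `M`-ball
  set τ : ℝ → ℝ := fun r ↦ ∑' a : ℕ, χ a r with hτ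
  have hτc : Continuous τ := continuous_tsum_of_eq_zero hχc fun a r hr ↦ hχa a r hr
  have hτge : ∀ a r, χ a r ≤ τ r := le_tsum_of_eq_zero hχ0 fun a r hr ↦ hχa a r hr
  set Φ : D → ℝ := fun x ↦ φ x + τ (s x) with hΦ
  have hΦc : Continuous Φ := hφ.continuous.add (hτc.comp hs.continuous)
  have hφΦ : ∀ x, φ x ≤ Φ x := fun x ↦ le_add_of_nonneg_right ((hχ0 0 _).trans (hτge 0 _))
  have hθΦ : ∀ a x, θ a x ≤ Φ x := fun a x ↦ (hθle a x).trans (by simp only [hΦ]; linarith [hτge a (s x)])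
  have hvolle : ∀ a, D.volW Φ ≤ D.volW (θ a) := fun a ↦ by
    refine withDensity_mono (ae_of_all _ fun x ↦ ?_)
    rw [ENNReal.coe_le_coe, ← NNReal.coe_le_coe, coe_weight, coe_weight]
    exact Real.exp_le_exp.2 (neg_le_neg (hθΦ a x))
  have hmemΦ : ∀ a, MemLp (u a) 2 (D.volW Φ) := fun a ↦ (hmem a).mono_measure (hvolle a)
  have hnormΦ : ∀ a, eLpNorm (u a) 2 (D.volW Φ) ≤ ENNReal.ofReal M := fun a ↦
    (eLpNorm_mono_measure _ (hvolle a)).trans (hnorm a)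
  -- the weights `w_N = 1_{s ≤ N} e^{-φ}`
  set w : ℕ → D → ℝ := fun N x ↦ {x | s x ≤ N}.indicator (fun x ↦ Real.exp (-φ x)) x with hw
  have hKm : ∀ N : ℕ, MeasurableSet {x : D | s x ≤ N} := fun N ↦ (isClosed_le hs.continuous continuous_const).measurableSet
  have hwm : ∀ N, Measurable (w N) := fun N ↦ (Real.measurable_exp.comp hφ.continuous.measurable.neg).indicator (hKm N)
  have hw0 : ∀ N x, 0 ≤ w N x := fun N x ↦ indicator_nonneg (fun y _ ↦ (Real.exp_pos _).le) _
  have hwC : ∀ N, ∃ C, 0 ≤ C ∧ ∀ x, w N x ≤ C * Real.exp (-Φ x) := by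
    intro N
    obtain ⟨B, hB⟩ := exists_bound_on_sublevel hsK (Q := fun x ↦ τ (s x)) (hτc.comp hs.continuous) (N : ℝ)
    refine ⟨Real.exp B, (Real.exp_pos _).le, fun x ↦ ?_⟩
    by_cases hx : x ∈ {x : D | s x ≤ N}
    · simp only [hw, indicator_of_mem hx]
      rw [← Real.exp_add]; exact Real.exp_le_exp.2 (by simp only [hΦ]; linarith [hB x hx])
    · simp only [hw, indicator_of_notMem hx]; positivity
  have hvw : ∀ N, ∀ᶠ a in atTop, ∫⁻ x, ENNReal.ofReal (‖u a x‖ ^ 2 * w N x) ∂D.vol ≤ ENNReal.ofReal (M ^ 2) := by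
    intro N
    filter_upwards [eventually_ge_atTop N] with a ha
    have hKa : ∀ x ∈ {x : D | s x ≤ N}, θ a x = φ x := fun x hx ↦ hθφ a x (le_trans hx (by exact_mod_cast ha))
    refine le_trans (lintegral_mono fun x ↦ ENNReal.ofReal_le_ofReal ?_) (lintegral_le_of_eLpNorm_le (hθc a) hM0 (hnorm a))
    by_cases hx : x ∈ {x : D | s x ≤ N}
    · simp only [hw, indicator_of_mem hx, hKa x hx]; exact le_rfl
    · simp only [hw, indicator_of_notMem hx, mul_zero]; positivity
  obtain ⟨U, hUmem, -, hweakU, hIN⟩ := exists_weak_limit hΦc (fun j ↦ locallyIntegrable_of_continuous (hg j).continuous)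
    hmemΦ hM0 hnormΦ hweak hwm hw0 hwC hvw
  have hUmeas : AEStronglyMeasurable U D.vol := aestronglyMeasurable_of_memLp_volW hΦc hUmem
  -- monotone convergence in `N`
  have hlin : ∫⁻ x, ENNReal.ofReal (‖U x‖ ^ 2 * Real.exp (-φ x)) ∂D.vol ≤ ENNReal.ofReal (M ^ 2) := by
    have hsup : (fun x ↦ ENNReal.ofReal (‖U x‖ ^ 2 * Real.exp (-φ x))) =
        fun x ↦ ⨆ N : ℕ, ENNReal.ofReal (‖U x‖ ^ 2 * w N x) := by
      funext x
      refine le_antisymm ?_ (iSup_le fun N ↦ ENNReal.ofReal_le_ofReal ?_)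
      · refine le_iSup_of_le ⌈s x⌉₊ (le_of_eq ?_)
        simp only [hw]
        rw [indicator_of_mem (show x ∈ {y : D | s y ≤ ((⌈s x⌉₊ : ℕ) : ℝ)} by exact Nat.le_ceil (s x))]
      · by_cases hx : x ∈ {y : D | s y ≤ N}
        · simp only [hw, indicator_of_mem hx]; exact le_rfl
        · simp only [hw, indicator_of_notMem hx, mul_zero]; positivity
    rw [hsup, lintegral_iSup' (fun N ↦ ?_) (ae_of_all _ fun x N N' hNN' ↦ ?_)]
    · exact iSup_le hIN
    · exact ENNReal.measurable_ofReal.comp_aemeasurable ((hUmeas.norm.aemeasurable.pow_const 2).mul (hwm N).aemeasurable)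
    · refine ENNReal.ofReal_le_ofReal (mul_le_mul_of_nonneg_left ?_ (sq_nonneg _))
      refine indicator_le_indicator_of_subset (fun y hy ↦ ?_) (fun _ ↦ (Real.exp_pos _).le) x
      have hy' : s y ≤ N := hy
      show s y ≤ (N' : ℝ)
      exact hy'.trans (by exact_mod_cast hNN')
  refine ⟨U, memLp_two_volW_of_lintegral_lt_top hφ.continuous hUmeas (hlin.trans_lt ENNReal.ofReal_lt_top), hweakU, ?_⟩
  have hmeas' : AEStronglyMeasurable (fun x ↦ ‖U x‖ ^ 2 * Real.exp (-φ x)) D.vol :=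
    (hUmeas.norm.pow 2).mul (Real.continuous_exp.comp hφ.continuous.neg).aestronglyMeasurable
  rw [integral_eq_lintegral_of_nonneg_ae (ae_of_all _ fun x ↦ by positivity) hmeas', ← hM2]
  have := ENNReal.toReal_mono ENNReal.ofReal_ne_top hlin
  rwa [ENNReal.toReal_ofReal (sq_nonneg _)] at this

end Limit


end RiemannDomain

end Literature.Analysis.Complex
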